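/-
Copyright: statement-level skeleton of a published paper (lit-balaban cell, Phase-2 proof seat p37 gen 106). No claims beyond
what the kernel checks below.
-/
import Literature.MathematicalPhysics.QuantumFieldTheory.Balaban1983to89.B3OnePIChainGlue
import Literature.MathematicalPhysics.QuantumFieldTheory.Balaban1983to89.B3GraphGlueDegree

/-!
# B3 — T. Bałaban, *(Higgs)₂,₃ quantum fields in a finite volume. III. Renormalization*, CMP **88** (1983) 411–445
[Balaban1983Higgs3] — p. 423 [PDF 13] (2.2) with p. 416 [PDF 6] (1.21): the DEGREE OF A CHAIN of two-leg insertions on the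
concrete graph model `B3Cor23Concrete.Graph` (p18) — `D(chain T l) = D(T) + Σ D(lᵢ) + 2·|l| − (differentiation corrections at
the |l| joining C₀^ε-lines)`

statement-level skeleton of published theorems with citation tags; proofs where landed; nothing here is a claim about
the Yang–Mills mass gap

PDF held: `paper:balaban1983-higgs-2-3-quantum-fields-finite-volume` (journal page = PDF page + 410); pp. 416, 422–423 read in the
text layer (`p0006.txt`, `p0012.txt`, `p0013.txt` of `lit read`).

CITATION HEADER (lean-in-tree rule).  lit-balaban TYPED SKELETON (HOME `run/shared/lean/pub/lit-balaban/`), PHASE 2, seat p37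
gen 106 (unit `lit-balaban-p37`; TAKING lines HOME/STATUS.md 2026-08-23, FILE G of BRICK 3, second part), located member for rows
**B3.Eq1.19-1.22** / **B3.Eq2.2-2.3** of `HOME/lit-balaban-r15/ROWS-B3.md` (fold owner r15, referee ref-4; zero head weight).
Siblings (same seat): `B3OnePIChainGlue` (`TwoLegGraph`, `glue2`, `chain`), `B3GraphGlueDegree` (`diffGain`, `deg_glue_scalar`).
REUSED BY NAME, nothing re-declared.

KIND «(ours)» (G.5-54): bookkeeping on our chain constructor; print provenance is claimed only for the quoted definitions; each
declaration's cite tag locates the printed notion it serves.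

THE PRINTED TEXT (verbatim).  p. 423 (2.2): *"D(G) = Σ_{v∈G} D_G(v) − d."*  p. 416 (1.21): *"G^ε = Σ_{n=0}^∞ C₀^ε[(−δm² + Σ^ε +
∂^{ε*}Σ₁^ε + Σ₁^{ε*}∂^ε + ∂^{ε*}Σ₂^ε∂^ε)C₀^ε]ⁿ"*.

WHAT IS TYPED / PROVED (two bookkeeping `def`s with bodies + kernel theorems; no `Prop` fact, no `sorry`; standard axioms).
`TwoLegGraph.diffGains`; `deg_glue2` (two pieces: `D = D₁ + D₂ + 2 − diffGain(out₁) − diffGain(in₂)`); `diffGain_glue2_legIn`,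
`diffGain_chain_legIn` (the in-leg of a chain keeps the gain of the first piece); `chainDiffGains T l` (the corrections at the
joining lines); **`deg_chain`**: `(chain T l).G.deg d = T.G.deg d + Σ lᵢ.G.deg d + 2·|l| − chainDiffGains T l`; `deg_chain_undiff`;
the displayed case **`deg_chain_pic1_pic1`**: D(①—C₀^ε—①) = 6 − 2d (each tadpole ① has D = 2 − d, p18's `g36c_deg`; the line adds 2).
HONEST SCOPE.  Bookkeeping identities only; nothing about signs of degrees, nothing analytic.
-/

namespace Literature.MathematicalPhysics.QuantumFieldTheory.Balaban1983to89.B3OnePIChainDegree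

open Finset B3Prop1 B3Cor23Concrete B3OnePIGraphs B3GraphGlueLegs B3GraphGlue B3GraphGlueDegree B3OnePIChainGlue

variable {nbar : ℕ}

/-! ## §4 The degree of a chain of two-leg insertions -/

section Chain

/-- The differentiation gains a two-leg insertion incurs when BOTH its channel legs become internal: `diffGain` at the in-leg plus
`diffGain` at the out-leg (each is the vertex's number of differentiations if that leg is its first φ′-leg, else 0).
[cite: Balaban1983Higgs3, (2.1) p.422] -/
def TwoLegGraph.diffGains (T : TwoLegGraph nbar) : ℕ :=
  diffGain T.G T.legIn T.legIn.1 + diffGain T.G T.legOut T.legOut.1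

/-- kernel: (2.2) of two insertions glued in a row — `D(glue2 T₁ T₂) = D(T₁) + D(T₂) + 2 − diffGain(out-leg of T₁) −
diffGain(in-leg of T₂)`. [cite: Balaban1983Higgs3, (2.2) p.423] -/
theorem deg_glue2 (d : ℕ) (T₁ T₂ : TwoLegGraph nbar) :
    (glue2 T₁ T₂).G.deg d = T₁.G.deg d + T₂.G.deg d + 2
      - ((diffGain T₁.G T₁.legOut T₁.legOut.1 + diffGain T₂.G T₂.legIn T₂.legIn.1 : ℕ) : ℚ) :=
  deg_glue_scalar (ha := T₁.out_ext) (hb := T₂.in_ext) (hab := out_isLeft_eq_in_isLeft T₁ T₂) d T₁.out_scalar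

/-- kernel: the differentiation gain at the in-leg of a glued pair is that of the first piece (the in-leg of `glue2 T₁ T₂` is the
in-leg of `T₁`, its vertex keeps its kind). [cite: Balaban1983Higgs3, (2.1) p.422] -/
theorem diffGain_glue2_legIn (T₁ T₂ : TwoLegGraph nbar) :
    diffGain (glue2 T₁ T₂).G (glue2 T₁ T₂).legIn (glue2 T₁ T₂).legIn.1 = diffGain T₁.G T₁.legIn T₁.legIn.1 := by
  obtain ⟨G, ⟨i, s⟩, lo, hi, ho, hne, hs, hos⟩ := T₁
  unfold diffGain glue2
  simp only [fst_legL]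
  have hk : (glue G T₂.G lo T₂.legIn ho T₂.in_ext (out_isLeft_eq_in_isLeft ⟨G, ⟨i, s⟩, lo, hi, ho, hne, hs, hos⟩ T₂)).kind
      (Fin.castAdd T₂.G.nV i) = G.kind i := Fin.append_left _ _ _
  by_cases hv : 0 < (G.kind i).scalarLegs
  · have hv' : 0 < ((glue G T₂.G lo T₂.legIn ho T₂.in_ext
        (out_isLeft_eq_in_isLeft ⟨G, ⟨i, s⟩, lo, hi, ho, hne, hs, hos⟩ T₂)).kind (Fin.castAdd T₂.G.nV i)).scalarLegs := by
      rw [hk]; exact hv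
    rw [dif_pos hv', dif_pos hv]
    have e : (legL G.kind T₂.G.kind ⟨i, s⟩ = ⟨Fin.castAdd T₂.G.nV i, .inl ⟨0, hv'⟩⟩) ↔ ((⟨i, s⟩ : Leg G.kind) = ⟨i, .inl ⟨0, hv⟩⟩) := by
      constructor
      · intro h
        have := congrArg (unglue G.kind T₂.G.kind) h
        rw [unglue_legL] at this
        have h2 : unglue G.kind T₂.G.kind ⟨Fin.castAdd T₂.G.nV i, .inl ⟨0, hv'⟩⟩ = Sum.inl ⟨i, .inl ⟨0, hv⟩⟩ :=
          unglue_legL G.kind T₂.G.kind ⟨i, .inl ⟨0, hv⟩⟩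
        rw [h2] at this
        exact Sum.inl.inj this
      · intro h
        rw [h]; rfl
    simp only [e, Fin.append_left]
  · have hv' : ¬ 0 < ((glue G T₂.G lo T₂.legIn ho T₂.in_ext
        (out_isLeft_eq_in_isLeft ⟨G, ⟨i, s⟩, lo, hi, ho, hne, hs, hos⟩ T₂)).kind (Fin.castAdd T₂.G.nV i)).scalarLegs := by
      rw [hk]; exact hv
    rw [dif_neg hv', dif_neg hv]

/-- kernel: the in-leg of a chain is the in-leg of its first piece, with the same differentiation gain.
[cite: Balaban1983Higgs3, (2.1) p.422] -/
theorem diffGain_chain_legIn (T : TwoLegGraph nbar) (l : List (TwoLegGraph nbar)) :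
    diffGain (chain T l).G (chain T l).legIn (chain T l).legIn.1 = diffGain T.G T.legIn T.legIn.1 := by
  cases l with
  | nil => rfl
  | cons T' l' => rw [chain_cons, diffGain_glue2_legIn]

/-- The differentiation corrections along a chain `T, l₁, …, l_r`: at each of the r joining lines, the gain at the out-leg of the
piece before it plus the gain at the in-leg of the piece after it. [cite: Balaban1983Higgs3, (2.1) p.422] -/
def chainDiffGains : TwoLegGraph nbar → List (TwoLegGraph nbar) → ℕ
  | _, [] => 0
  | T, T' :: l => diffGain T.G T.legOut T.legOut.1 + diffGain T'.G T'.legIn T'.legIn.1 + chainDiffGains T' l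

/-- **(2.2) OF A CHAIN**: `D(chain T l) = D(T) + Σ D(lᵢ) + 2·|l| − (differentiation corrections at the |l| joining lines)` — each
joining C₀^ε-line raises the degree by 2, less the differentiations that come to act on it. [cite: Balaban1983Higgs3, (2.2) p.423] -/
theorem deg_chain (d : ℕ) (T : TwoLegGraph nbar) (l : List (TwoLegGraph nbar)) :
    (chain T l).G.deg d = T.G.deg d + (l.map fun T' => T'.G.deg d).sum + 2 * (l.length : ℚ) - (chainDiffGains T l : ℚ) := by
  induction l generalizing T with
  | nil => simp [chainDiffGains]
  | cons T' l ih =>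
      rw [chain_cons, deg_glue2, ih T', diffGain_chain_legIn]
      simp only [chainDiffGains, List.map_cons, List.sum_cons, List.length_cons]
      push_cast
      ring

/-- kernel: with no differentiation corrections (e.g. all pieces glued at undifferentiated φ′-legs), `D(chain) = D(T) + Σ D(lᵢ) +
2·|l|`. [cite: Balaban1983Higgs3, (2.2) p.423] -/
theorem deg_chain_undiff (d : ℕ) (T : TwoLegGraph nbar) (l : List (TwoLegGraph nbar)) (h : chainDiffGains T l = 0) :
    (chain T l).G.deg d = T.G.deg d + (l.map fun T' => T'.G.deg d).sum + 2 * (l.length : ℚ) := by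
  rw [deg_chain, h]
  push_cast
  ring

end Chain

/-! ## The displayed case: the degree of the n = 2 term ①—C₀^ε—① of (1.21) -/

section Picture

open B3Sect3LowestOrderGraphs

/-- kernel: no differentiation corrections along the chain ①—① (the vertex (1.6) carries no differentiation).
[cite: Balaban1983Higgs3, (2.1) p.422] -/
theorem chainDiffGains_pic1_pic1 : chainDiffGains (pic1 nbar) [pic1 nbar] = 0 := by
  show diffGain (g36c nbar) (pic1 nbar).legOut (0 : Fin 1) + diffGain (g36c nbar) (pic1 nbar).legIn (0 : Fin 1) + 0 = 0
  have h : ∀ x : Leg (g36c nbar).kind, diffGain (g36c nbar) x (0 : Fin 1) = 0 := fun x => by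
    unfold diffGain
    split_ifs <;> rfl
  rw [h, h]

/-- **D(①—C₀^ε—①) = 2·(2 − d) + 2 = 6 − 2d** (p. 435 (3.6): each tadpole ① has D = −d + 2 (p18's `g36c_deg`); the joining line adds
2): in d = 3 this is 0, in d = 2 it is 2. [cite: Balaban1983Higgs3, (2.2) p.423] -/
theorem deg_chain_pic1_pic1 (d : ℕ) : (chain (pic1 nbar) [pic1 nbar]).G.deg d = 6 - 2 * (d : ℚ) := by
  rw [deg_chain_undiff d _ _ chainDiffGains_pic1_pic1]
  simp only [List.map_cons, List.map_nil, List.sum_cons, List.sum_nil, List.length_cons, List.length_nil]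
  rw [show (pic1 nbar).G = g36c nbar from rfl, g36c_deg]
  push_cast
  ring

end Picture

end Literature.MathematicalPhysics.QuantumFieldTheory.Balaban1983to89.B3OnePIChainDegree
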